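import Mathlib
import Summits.CriticalPhenomena.PercolationContinuityZ3.Theses.PercBudgetLadder
import Summits.CriticalPhenomena.PercolationContinuityZ3.Theorems.PinholeClosing.Negative.PinholeClosingBaseline
import Summits.CriticalPhenomena.PercolationContinuityZ3.Theorems.PercBudgetLadderPinholeClosingStubHarrisTiles
import Summits.CriticalPhenomena.PercolationContinuityZ3.Theorems.PercBudgetLadderPinholeClosingStubPinholeBehindPlane
import Summits.CriticalPhenomena.PercolationContinuityZ3.Theorems.PercBudgetLadderPinholeClosingStubSlabTiling
import Summits.CriticalPhenomena.PercolationContinuityZ3.Theorems.PercBudgetLadderPinholeClosingStubSignedSymmetry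
import Summits.CriticalPhenomena.PercolationContinuityZ3.Theorems.PercBudgetLadderSufficesTarget
import Summits.CriticalPhenomena.PercolationContinuityZ3.Theorems.PercBudgetLadderBlockingVanishesOfTheta
import Literature.Probability.LatticeModels.ThermodynamicLimit
import HarnessLib

/-!
# Crux `PercBudgetLadder.PinholeClosing` (stmt-CriticalPhenomena-5249), line `halfspace-polarisation` — the `k = 0` rung and the certified reduction

Lead `prover-line-stmt-CriticalPhenomena-5249-0`.  Composition of the four LANDED stubs of the line
(`stub_pinholeBehindPlane`, `stub_signedSymmetry`, `stub_harrisTiles`, `stub_slabTiling`) into: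

* `pinholeClosing_zeroRung` / `pinholeClosing_zero` — the **`k = 0` instance of the crux, unconditionally**: for every
  `l ≥ 2`, `n ≥ 1`, `c ≥ 0`, if the critical annulus `box n → ∂ⁱⁿ box (l n)` of `ℤ³` can be blocked by closing at most ONE
  edge with `P_{p_c}`-probability `≥ c`, then the annulus `box n → ∂ⁱⁿ box (2 l n)` is blocked outright (budget `0`) with
  probability `≥ (c/6) ^ (6 (2l+1)³)` ("one pinhole costs O(1), given room", at the crux's literal outer radius `2ln`).
  Mechanism (half-space polarisation): a single pinhole is a lattice edge and lies strictly behind one of the six coordinate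
  planes, so the corresponding closed half-box is crossing-free (`stub_pinholeBehindPlane`); by the point group all six
  half-boxes and all their translates have the same blocking probability `≥ c/6` (`stub_signedSymmetry`); Harris–FKG makes
  the `6(2l+1)³` translated half-box tiles of the slab `[ln, 2ln]` simultaneously blocked with probability `≥ (c/6)^N`
  (`stub_harrisTiles`); and a lattice crossing of `A(n, 2ln)` would cross one tile inside its front half (`stub_slabTiling`).
* `pinholeClosing_of_halfspaceShare` — the **certified reduction** of the whole crux to the line's single open stub
  `stub_halfspaceShare` (stated INLINE as the hypothesis, verbatim the registered signature): budget-`(k+2)` tightness at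
  `(n, ln)` ⇒ half-space blocking of one upper half-box at some radius in `[ln, 2ln − n − 1]`, uniformly in `n`.  The
  hypothesis is an OPEN statement of the same strength class as the crux (Disproof §7: its refutation would prove
  `BudgetTightness` and refute uniform half-space RSW); nothing here asserts it.
* `budgetZero_of_halfspaceShare` — what the line really yields under that hypothesis: the budget-`0` strengthening.
* `critAnnulusBlockedIO_of_budgetOneTightness` / `percolationContinuityZ3_of_budgetOneTightness` — corollaries of the `k = 0`
  rung: budget-ONE tightness at one aspect ratio (the `k = 1` instance of `BudgetTightness`, inlined, OPEN) already gives the route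
  target `CritAnnulusBlockedIO` and hence `θ(p_c) = 0` via the route's proved `SufficesTarget` + `BlockingVanishesOfTheta`.

No new definitions: every statement is in the tree's vocabulary (raw set-builders, as in the stub files).
-/

noncomputable section

namespace Summit.CriticalPhenomena.PercolationContinuityZ3.Theorems

open MeasureTheory Filter
open Literature.Probability.Percolation Literature.Probability.LatticeModels
open Summit.CriticalPhenomena.PercolationContinuityZ3.Theorems.PinholeClosing.Negative
open Summit.CriticalPhenomena.PercolationContinuityZ3.Theses

namespace ZeroRung

/-- The tile index set has `6 (2l+1)³` elements (three axes, two signs, a `(2l+1)³` lateral grid). -/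
theorem card_tiles (l : ℕ) : ((Finset.univ : Finset (Fin 3)) ×ˢ (({1, -1} : Finset ℤ) ×ˢ box 3 l)).card = 6 * (2 * l + 1) ^ 3 := by
  rw [Finset.card_product, Finset.card_product, card_box]
  simp only [Finset.card_univ, Fintype.card_fin]
  rw [Finset.card_insert_of_notMem (by simp), Finset.card_singleton]
  ring

/-- **Key step** (tiles ⇒ blocked annulus).  If the canonical upper half-box of `A(n, L)` is crossing-free with
probability `≥ s ≥ 0`, and `[a, a+L]` is a slab with `a ≥ n+1`, `L ≥ n+1`, `a + L = 2ln`, then `A(n, 2ln)` is blocked at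
budget `0` with probability `≥ s ^ (6(2l+1)³)`: symmetry puts the bound on every tile, Harris intersects the tiles, and the
slab tiling (a.s., on lattice configurations) forbids a crossing. -/
theorem blocked_of_halfspace_bound {l n a L : ℕ} {s : ℝ} (hn : 1 ≤ n) (ha : n + 1 ≤ a) (hL : n + 1 ≤ L)
    (haL : a + L = 2 * l * n) (hs : 0 ≤ s)
    (hshare : s ≤ (bondPercolation (zdGraph 3) (criticalProbI 3)).real
      {ω : BondConfig (Site 3) | ¬ ∃ x ∈ box 3 n, ∃ y ∈ innerBoundary (zdGraph 3) (box 3 L), ω ∈ openConnIn {v : Site 3 | v ∈ box 3 L ∧ 0 ≤ v 0} x y}) :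
    s ^ (6 * (2 * l + 1) ^ 3) ≤ (bondPercolation (zdGraph 3) (criticalProbI 3)).real
      {ω : BondConfig (Site 3) | ∃ S : Finset (Sym2 (Site 3)), S.card ≤ 0 ∧ ¬ ∃ x ∈ box 3 n, ∃ y ∈ innerBoundary (zdGraph 3) (box 3 (2 * l * n)), (ω \ (↑S : Set (Sym2 (Site 3)))) ∈ openConnIn (↑(box 3 (2 * l * n)) : Set (Site 3)) x y} := by
  have htile : ∀ t ∈ (Finset.univ : Finset (Fin 3)) ×ˢ (({1, -1} : Finset ℤ) ×ˢ box 3 l), s ≤ (bondPercolation (zdGraph 3) (criticalProbI 3)).real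
      {ω : BondConfig (Site 3) | ¬ ∃ x ∈ (box 3 n).image (· + (Function.update ((2 * (n : ℤ) + 1) • t.2.2) t.1 (t.2.1 * (a : ℤ)))), ∃ y ∈ (innerBoundary (zdGraph 3) (box 3 L)).image (· + (Function.update ((2 * (n : ℤ) + 1) • t.2.2) t.1 (t.2.1 * (a : ℤ)))), ω ∈ openConnIn {v : Site 3 | v - (Function.update ((2 * (n : ℤ) + 1) • t.2.2) t.1 (t.2.1 * (a : ℤ))) ∈ box 3 L ∧ 0 ≤ t.2.1 * (v t.1 - (Function.update ((2 * (n : ℤ) + 1) • t.2.2) t.1 (t.2.1 * (a : ℤ))) t.1)} x y} := by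
    intro t ht
    have hσ : t.2.1 = 1 ∨ t.2.1 = -1 := by
      simp only [Finset.mem_product, Finset.mem_univ, true_and, Finset.mem_insert, Finset.mem_singleton] at ht
      exact ht.1
    rw [stub_signedSymmetry t.1 t.2.1 _ n L hσ]
    exact hshare
  have hH := stub_harrisTiles n l a L s hs htile
  rw [card_tiles] at hH
  refine hH.trans (real_mono_of_lattice fun ω hω hmem => ?_)
  refine ⟨∅, by simp, ?_⟩
  rw [Finset.coe_empty, Set.sdiff_empty]
  exact stub_slabTiling n l a L hn ha hL haL ω hω fun t ht => Set.mem_iInter₂.1 hmem t ht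

end ZeroRung

/-- **The `k = 0` rung of `PinholeClosing`, with its constant.**  For `l ≥ 2`, `n ≥ 1`, `c ≥ 0`: if
`P_{p_c}(A(n, ln) is blocked after closing ≤ 1 edge) ≥ c` then `P_{p_c}(A(n, 2ln) is blocked) ≥ (c/6)^(6(2l+1)³)`.
Proof: `stub_pinholeBehindPlane` and `stub_signedSymmetry` give the canonical upper half-box of `A(n, ln)` crossing-free
with probability `≥ c/6`; then `ZeroRung.blocked_of_halfspace_bound` with the slab `a = L = ln`. -/
theorem pinholeClosing_zeroRung (l n : ℕ) (c : ℝ) (hl : 2 ≤ l) (hn : 1 ≤ n) (hc : 0 ≤ c)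
    (hprem : c ≤ (bondPercolation (zdGraph 3) (criticalProbI 3)).real
      {ω : BondConfig (Site 3) | ∃ S : Finset (Sym2 (Site 3)), S.card ≤ 1 ∧ ¬ ∃ x ∈ box 3 n, ∃ y ∈ innerBoundary (zdGraph 3) (box 3 (l * n)), (ω \ (↑S : Set (Sym2 (Site 3)))) ∈ openConnIn (↑(box 3 (l * n)) : Set (Site 3)) x y}) :
    (c / 6) ^ (6 * (2 * l + 1) ^ 3) ≤ (bondPercolation (zdGraph 3) (criticalProbI 3)).real
      {ω : BondConfig (Site 3) | ∃ S : Finset (Sym2 (Site 3)), S.card ≤ 0 ∧ ¬ ∃ x ∈ box 3 n, ∃ y ∈ innerBoundary (zdGraph 3) (box 3 (2 * l * n)), (ω \ (↑S : Set (Sym2 (Site 3)))) ∈ openConnIn (↑(box 3 (2 * l * n)) : Set (Site 3)) x y} := by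
  have hsum := hprem.trans (stub_pinholeBehindPlane n (l * n))
  rw [Finset.sum_congr rfl fun ax hax => stub_signedSymmetry ax.1 ax.2 (0 : Site 3) n (l * n) (by
      simp only [Finset.mem_product, Finset.mem_univ, true_and, Finset.mem_insert, Finset.mem_singleton] at hax
      exact hax), Finset.sum_const, Finset.card_product] at hsum
  simp only [Finset.card_univ, Fintype.card_fin, nsmul_eq_mul] at hsum
  rw [Finset.card_insert_of_notMem (by simp), Finset.card_singleton] at hsum
  push_cast at hsum
  have hshare : c / 6 ≤ (bondPercolation (zdGraph 3) (criticalProbI 3)).real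
      {ω : BondConfig (Site 3) | ¬ ∃ x ∈ box 3 n, ∃ y ∈ innerBoundary (zdGraph 3) (box 3 (l * n)), ω ∈ openConnIn {v : Site 3 | v ∈ box 3 (l * n) ∧ 0 ≤ v 0} x y} := by
    linarith
  have h2n : 2 * n ≤ l * n := Nat.mul_le_mul_right n hl
  exact ZeroRung.blocked_of_halfspace_bound (l := l) (a := l * n) (L := l * n) hn (by omega) (by omega) (by ring)
    (by positivity) hshare

/-- **`PinholeClosing` at `k = 0`** (the crux's `k = 0` instance verbatim, with `c' = (c/6)^(6(2l+1)³)`): for all `l ≥ 2` and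
`c > 0` there is `c' > 0` such that for every `n ≥ 1`, budget-`1` blocking of `A(n, ln)` with probability `≥ c` forces
budget-`0` blocking of `A(n, 2ln)` with probability `≥ c'`. -/
theorem pinholeClosing_zero :
    ∀ (l : ℕ) (c : ℝ), 2 ≤ l → 0 < c → ∃ c' : ℝ, 0 < c' ∧ ∀ n : ℕ, 1 ≤ n →
      c ≤ (bondPercolation (zdGraph 3) (criticalProbI 3)).real
        {ω : BondConfig (Site 3) | ∃ S : Finset (Sym2 (Site 3)), S.card ≤ 0 + 1 ∧ ¬ ∃ x ∈ box 3 n, ∃ y ∈ innerBoundary (zdGraph 3) (box 3 (l * n)), (ω \ (↑S : Set (Sym2 (Site 3)))) ∈ openConnIn (↑(box 3 (l * n)) : Set (Site 3)) x y} →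
      c' ≤ (bondPercolation (zdGraph 3) (criticalProbI 3)).real
        {ω : BondConfig (Site 3) | ∃ S : Finset (Sym2 (Site 3)), S.card ≤ 0 ∧ ¬ ∃ x ∈ box 3 n, ∃ y ∈ innerBoundary (zdGraph 3) (box 3 (2 * l * n)), (ω \ (↑S : Set (Sym2 (Site 3)))) ∈ openConnIn (↑(box 3 (2 * l * n)) : Set (Site 3)) x y} := by
  intro l c hl hc
  exact ⟨(c / 6) ^ (6 * (2 * l + 1) ^ 3), by positivity,
    fun n hn hprem => pinholeClosing_zeroRung l n c hl hn hc.le (by simpa using hprem)⟩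

/-- **What the line yields under its open stub: the budget-`0` strengthening.**  If `stub_halfspaceShare` holds
(hypothesis, verbatim the registered open stub: budget-`(k+2)` tightness at `(n, ln)` with probability `≥ c` forces the
canonical upper half-box of `A(n, L')` to be crossing-free with probability `≥ c₁ > 0` for some `L' ∈ [ln, 2ln − n − 1]`,
uniformly in `n ≥ 1`), then for every `k`: budget-`(k+1)` blocking of `A(n, ln)` with probability `≥ c` forces budget-`0`
blocking of `A(n, 2ln)` with probability `≥ c' > 0`, uniformly in `n ≥ 1`. -/
theorem budgetZero_of_halfspaceShare
    (hShare : (∀ (k l : ℕ) (c : ℝ), 2 ≤ l → 0 < c → ∃ c₁ : ℝ, 0 < c₁ ∧ ∀ n : ℕ, 1 ≤ n →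
      c ≤ (bondPercolation (zdGraph 3) (criticalProbI 3)).real
        {ω : BondConfig (Site 3) | ∃ S : Finset (Sym2 (Site 3)), S.card ≤ k + 1 + 1 ∧ ¬ ∃ x ∈ box 3 n, ∃ y ∈ innerBoundary (zdGraph 3) (box 3 (l * n)), (ω \ (↑S : Set (Sym2 (Site 3)))) ∈ openConnIn (↑(box 3 (l * n)) : Set (Site 3)) x y} →
        ∃ L' : ℕ, l * n ≤ L' ∧ L' + n + 1 ≤ 2 * l * n ∧ c₁ ≤ (bondPercolation (zdGraph 3) (criticalProbI 3)).real
          {ω : BondConfig (Site 3) | ¬ ∃ x ∈ box 3 n, ∃ y ∈ innerBoundary (zdGraph 3) (box 3 L'), ω ∈ openConnIn {v : Site 3 | v ∈ box 3 L' ∧ 0 ≤ v 0} x y})) :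
    ∀ (k l : ℕ) (c : ℝ), 2 ≤ l → 0 < c → ∃ c' : ℝ, 0 < c' ∧ ∀ n : ℕ, 1 ≤ n →
      c ≤ (bondPercolation (zdGraph 3) (criticalProbI 3)).real
        {ω : BondConfig (Site 3) | ∃ S : Finset (Sym2 (Site 3)), S.card ≤ k + 1 ∧ ¬ ∃ x ∈ box 3 n, ∃ y ∈ innerBoundary (zdGraph 3) (box 3 (l * n)), (ω \ (↑S : Set (Sym2 (Site 3)))) ∈ openConnIn (↑(box 3 (l * n)) : Set (Site 3)) x y} →
      c' ≤ (bondPercolation (zdGraph 3) (criticalProbI 3)).real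
        {ω : BondConfig (Site 3) | ∃ S : Finset (Sym2 (Site 3)), S.card ≤ 0 ∧ ¬ ∃ x ∈ box 3 n, ∃ y ∈ innerBoundary (zdGraph 3) (box 3 (2 * l * n)), (ω \ (↑S : Set (Sym2 (Site 3)))) ∈ openConnIn (↑(box 3 (2 * l * n)) : Set (Site 3)) x y} := by
  intro k l c hl hc
  cases k with
  | zero => exact pinholeClosing_zero l c hl hc
  | succ j =>
    obtain ⟨c₁, hc₁, H⟩ := hShare j l c hl hc
    refine ⟨c₁ ^ (6 * (2 * l + 1) ^ 3), pow_pos hc₁ _, fun n hn hprem => ?_⟩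
    obtain ⟨L', hL1, hL2, hshare⟩ := H n hn hprem
    have h2n : 2 * n ≤ l * n := Nat.mul_le_mul_right n hl
    exact ZeroRung.blocked_of_halfspace_bound (l := l) (a := 2 * l * n - L') (L := L') hn (by omega) (by omega)
      (by omega) hc₁.le hshare

/-- **Certified reduction of the crux to the line's open stub**: `stub_halfspaceShare → PinholeClosing`
(budget `0 ≤ k` after `budgetZero_of_halfspaceShare`).  The hypothesis is open (crux-sized, Disproof §7); this theorem is
the glue a planner needs to promote it. -/
theorem pinholeClosing_of_halfspaceShare
    (hShare : (∀ (k l : ℕ) (c : ℝ), 2 ≤ l → 0 < c → ∃ c₁ : ℝ, 0 < c₁ ∧ ∀ n : ℕ, 1 ≤ n →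
      c ≤ (bondPercolation (zdGraph 3) (criticalProbI 3)).real
        {ω : BondConfig (Site 3) | ∃ S : Finset (Sym2 (Site 3)), S.card ≤ k + 1 + 1 ∧ ¬ ∃ x ∈ box 3 n, ∃ y ∈ innerBoundary (zdGraph 3) (box 3 (l * n)), (ω \ (↑S : Set (Sym2 (Site 3)))) ∈ openConnIn (↑(box 3 (l * n)) : Set (Site 3)) x y} →
        ∃ L' : ℕ, l * n ≤ L' ∧ L' + n + 1 ≤ 2 * l * n ∧ c₁ ≤ (bondPercolation (zdGraph 3) (criticalProbI 3)).real
          {ω : BondConfig (Site 3) | ¬ ∃ x ∈ box 3 n, ∃ y ∈ innerBoundary (zdGraph 3) (box 3 L'), ω ∈ openConnIn {v : Site 3 | v ∈ box 3 L' ∧ 0 ≤ v 0} x y})) :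
    PercBudgetLadder.PinholeClosing := by
  intro k l c hl hc
  obtain ⟨c', hc', hstep⟩ := budgetZero_of_halfspaceShare hShare k l c hl hc
  refine ⟨c', hc', fun n hn hprem => (hstep n hn hprem).trans (measureReal_mono ?_)⟩
  rintro ω ⟨S, hS, hb⟩
  exact ⟨S, hS.trans (Nat.zero_le k), hb⟩

/-- **Budget-ONE tightness already gives the route target.**  If for some aspect `l ≥ 2` and `c > 0` the critical annulus
`A(n, ln)` can be blocked by closing at most ONE edge with probability `≥ c` for infinitely many `n` (the `k = 1` instance of
`BudgetTightness`, inlined), then `CritAnnulusBlockedIO` holds (at aspect `2l`, constant `(c/6)^(6(2l+1)³)`), by the `k = 0` rung. -/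
theorem critAnnulusBlockedIO_of_budgetOneTightness
    (h : ∃ (l : ℕ) (c : ℝ), 2 ≤ l ∧ 0 < c ∧ ∀ N : ℕ, ∃ n : ℕ, N ≤ n ∧ c ≤ (bondPercolation (zdGraph 3) (criticalProbI 3)).real
      {ω : BondConfig (Site 3) | ∃ S : Finset (Sym2 (Site 3)), S.card ≤ 1 ∧ ¬ ∃ x ∈ box 3 n, ∃ y ∈ innerBoundary (zdGraph 3) (box 3 (l * n)), (ω \ (↑S : Set (Sym2 (Site 3)))) ∈ openConnIn (↑(box 3 (l * n)) : Set (Site 3)) x y}) :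
    PercBudgetLadder.CritAnnulusBlockedIO := by
  obtain ⟨l, c, hl, hc, hio⟩ := h
  refine ⟨2 * l, (c / 6) ^ (6 * (2 * l + 1) ^ 3), by omega, by positivity, fun N => ?_⟩
  obtain ⟨n, hn, hprem⟩ := hio (N + 1)
  refine ⟨n, by omega, ?_⟩
  have key := pinholeClosing_zeroRung l n c hl (by omega) hc.le hprem
  refine key.trans (measureReal_mono ?_)
  rintro ω ⟨S, hS, hb⟩
  obtain rfl : S = ∅ := Finset.card_eq_zero.1 (Nat.le_zero.1 hS)
  simpa using hb

/-- **`θ(p_c) = 0` on `ℤ³` from budget-one tightness** (conditional; the hypothesis is the open `k = 1` instance of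
`BudgetTightness`, inlined): `critAnnulusBlockedIO_of_budgetOneTightness`, then the route's proved `SufficesTarget` and
`BlockingVanishesOfTheta` (zero-one law).  Records that, through this line, the single open input of the whole ladder is
bounded-budget tightness with budget ONE at one aspect ratio. -/
theorem percolationContinuityZ3_of_budgetOneTightness
    (h : ∃ (l : ℕ) (c : ℝ), 2 ≤ l ∧ 0 < c ∧ ∀ N : ℕ, ∃ n : ℕ, N ≤ n ∧ c ≤ (bondPercolation (zdGraph 3) (criticalProbI 3)).real
      {ω : BondConfig (Site 3) | ∃ S : Finset (Sym2 (Site 3)), S.card ≤ 1 ∧ ¬ ∃ x ∈ box 3 n, ∃ y ∈ innerBoundary (zdGraph 3) (box 3 (l * n)), (ω \ (↑S : Set (Sym2 (Site 3)))) ∈ openConnIn (↑(box 3 (l * n)) : Set (Site 3)) x y}) :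
    _root_.PercolationContinuityZ3 :=
  sufficesTarget_proof (critAnnulusBlockedIO_of_budgetOneTightness h) BlockingVanishesOfTheta_proof

end Summit.CriticalPhenomena.PercolationContinuityZ3.Theorems

end
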